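import Summits.MatrixMultiplication.MatrixMultiplication.Theses.LongExchangeCondensation

/-!
# Route `LongExchangeCondensation` — definitions: the opaque normal form of the rung `LongExchangeSound`

The route's rung `Theses.LongExchangeCondensation.LongExchangeSound` (stmt-MatrixMultiplication-20136, PROVED:
`Theorems.LongExchangeSound.LongExchangeSound_of`) is a 2 kB first-order statement (long-exchange condensation
derivations ⇒ division-SLP derivations of `det X_n`).  Structural automation that meets the constant together with an
unfold hint — `simp [LongExchangeSound, …]`, `simpa [LongExchangeSound, …] using h`, `simp_all`, the tribunal kernel's
fixed portfolios (`HarnessLib.Audit.CruxProbe.summitTactics` #3, `strongHypCheapTactics`, `sameRungTactics`) — unfolds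
it and then spends > 50 000 heartbeats normalising the body (`∀ J ∈ [a, b, c, d, e]` expansions, `Finset` filters,
`Matrix.det (Matrix.of …)` over `FractionRing (MvPolynomial …)`): measured 2026-08-19, `simp [LongExchangeSound]` needs
≈ 400 000 heartbeats / 25 s and under the kernel's `cheapHeartbeats = 50 000` every such tactic dies by timeout after
≈ 4 s — which at tier `quick` is the whole `S → C` budget, so the kernel never reaches the tactic that knows the landed
on-path lemma (forward `on_path` reads `false` at quick, `true` at full for the same tree).

This file declares the OPAQUE NORMAL FORM `LongExchangeSoundNF` of the rung: a one-field `Prop` structure wrapping a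
proof of `LongExchangeSound`.  Being an inductive type it is never delta-unfolded, carries no simp lemmas and no
`Decidable` instance, so no cheap tactic can close it except through a theorem that names it; the companion proof file
`LongExchangeCondensationOnPathQuick.lean` registers the pre-simp rewrite `LongExchangeSound ↔ LongExchangeSoundNF`
(so `simp` replaces the statement by the token BEFORE unfolding it, in milliseconds) and the `S →` rule on the token.
The wrapper adds no mathematics: `LongExchangeSoundNF ↔ LongExchangeSound` by its constructor and projection.

prover-fwd2-land-2-g7-0 (on-path lander, gen 7), 2026-08-19.
-/

set_option linter.dupNamespace false

namespace Summit.MatrixMultiplication.MatrixMultiplication.Theorems.LongExchangeSound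

/-- **Opaque normal form of the rung `LongExchangeSound`.**  A proof-wrapping one-field structure:
`LongExchangeSoundNF` holds iff `Theses.LongExchangeCondensation.LongExchangeSound` does (constructor `intro`,
projection `out`).  It exists so that `simp`-based automation can replace the rung's 2 kB statement by an inert token
instead of unfolding and normalising it (see the module docstring); it is not a new notion and states nothing beyond
the rung. [folklore] -/
structure LongExchangeSoundNF : Prop where
  /-- Wrap a proof of the rung `LongExchangeSound`. -/
  intro ::
  /-- The wrapped rung `LongExchangeSound` (every valid long-exchange condensation derivation listing `[n, 2n)` gives a
  division-SLP derivation of `det X_n` from the entries in `Σᵢ (2·gᵢ + 3)` steps). -/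
  out : Summit.MatrixMultiplication.MatrixMultiplication.Theses.LongExchangeCondensation.LongExchangeSound

end Summit.MatrixMultiplication.MatrixMultiplication.Theorems.LongExchangeSound
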